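import Summits.ABC.IUTFork.Cor312UnitCosetCountermodel
import Mathlib.Tactic.NormNum.Prime
import HarnessLib

/-!
# [IUTchIII] Cor. 3.12 — the COSET test model, III: two distinct possible images; the package

Proof-only file (D-0012; no definition, no `Prop` fact) of the abc-iut cell (wave-4 prover abc-iut-w4-d101, gen 4). TAKES NO SIDE on
[IUTchIII] Cor. 3.12. Sequel to `Cor312UnitCosetThm311`/`Cor312UnitCosetCountermodel` (the coset setting `cSetting p` over the unit shells:
three pins, BridgeHyps, AbsLogQPos, `inflation`, `¬S`). Here: **`possibleImages_moved`** — for `p ≥ 7`, at label `1`, the (Ind2)-family of the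
unit `2` carries the Θ-pilot region `±q·(1+p𝒪)` to the possible image `±4q·(1+p𝒪)`, a DIFFERENT set (the indeterminacies of [IUTchIII]
Thm. 3.11 (i) genuinely MOVE the Θ-pilot region — in every earlier model of record they fix it, abc-iut-w5-d068 `Cor312PinnedIndTrivial`
p429312); and the package **`coset_countermodel`** (`p = 7`): typed Thm. 3.11 (i)–(iii) ∧ BridgeHyps ∧ AbsLogQPos ∧ THREE PINS ∧ ¬GapA3 ∧
¬GapH3 ∧ ¬`PilotKummerIndRelated` (= ¬S) ∧ ¬`PilotKummerCompat` ∧ ¬R3 ∧ ¬Licence ∧ ¬Statement ∧ `−|log(Θ)| = (5/2)·(−|log(q)|)` ∧ [Θ-region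
MOVED] ∧ [every possible image STRICTLY inflated by the hull, set and log-volume] ∧ [indeterminacy group INFINITE]. Interface level, one
place (`toyIndex`, `l⋇ = 2`); not a model of initial Θ-data; no judgement on print. [claim: Mochizuki2012, status: disputed]
[cite: ScholzeStix2018, §2.2 pp. 9–10]
-/

noncomputable section

namespace Summit.ABC.IUTFork.Cor312Vol.UnitCoset

open Set Thm311 Cor312 Cor312.Checks Cor312.IdentifiedNonVacuity NaiveWitness PinnedWitness UnitWitness Literature.IUT.LogThetaLattice

variable (p : ℕ) [hp : Fact p.Prime]

omit hp in
/-- A natural number `< p` and `> 0` is a `p`-adic unit. [folklore] -/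
theorem isPUnit_of_lt {n : ℕ} (h0 : 0 < n) (hn : n < p) : IsPUnit p (n : ℚ) := by
  refine ⟨by exact_mod_cast h0.ne', ?_⟩
  rw [← padicValRat_of_nat, Nat.cast_eq_zero]
  exact padicValNat.eq_zero_of_not_dvd fun hd => absurd (Nat.le_of_dvd h0 hd) (not_le.2 hn)

/-- **THE INDETERMINACIES MOVE THE Θ-REGION** (`p ≥ 7`, label `1`): the (Ind2)-family of the unit `2` carries the Θ-pilot region `±q·(1+p𝒪)` to the
possible image `±4q·(1+p𝒪)`, a DIFFERENT set (`4q ∉ ±q(1+p𝒪)`: `v_p(3q) = v_p(5q) = 1 < 2`). [folklore] -/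
theorem possibleImages_moved (h7 : 7 ≤ p) (vQ : toyIndex.VQ) :
    ∃ Φ ∈ Setting.indGroup (cFull p).toSituation,
      Φ 1 vQ '' (cSetting p).thetaRegion3 1 vQ ∈ (cSetting p).possibleImages 1 vQ ∧
        Φ 1 vQ '' (cSetting p).thetaRegion3 1 vQ ≠ (cSetting p).thetaRegion3 1 vQ := by
  have h2 : IsPUnit p (2 : ℚ) := by exact_mod_cast isPUnit_of_lt p (n := 2) (by norm_num) (by omega)
  have h3 : IsPUnit p (3 : ℚ) := by exact_mod_cast isPUnit_of_lt p (n := 3) (by norm_num) (by omega)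
  have h5 : IsPUnit p (5 : ℚ) := by exact_mod_cast isPUnit_of_lt p (n := 5) (by norm_num) (by omega)
  have hp0 : (p : ℚ) ≠ 0 := Nat.cast_ne_zero.2 hp.out.ne_zero
  have hvp : padicValRat p (p : ℚ) = 1 := padicValRat.self hp.out.one_lt
  have hq : qpow p 1 = p := by
    have h1 : ((1 : toyIndex.Label) : ℕ) = 1 := rfl
    unfold qpow; rw [h1]; norm_num
  have hone : ((1 : toyIndex.Label) : ℕ) + 1 = 2 := rfl
  refine ⟨uFam p 2 h2.1, uFam_mem_closure p h2, ⟨_, uFam_mem_closure p h2, rfl⟩, fun h => ?_⟩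
  rw [cSetting_thetaRegion3, cSetting_thetaRegion p 0 (by decide), hq,
    image_pair_of_unit p (h2.mul h2) (fun x => by rw [line_uFam, hone]; ring)] at h
  have hmem : (line 1 vQ).symm (2 * 2 * (p : ℚ)) ∈ pair p 1 vQ p := h ▸ rep_mem_pair p 1 vQ _
  have h3p : padicValRat p (2 * 2 * (p : ℚ) - p) = 1 := by
    rw [show (2 * 2 * (p : ℚ) - p) = 3 * p by ring, padicValRat.mul h3.1 hp0, h3.2, hvp, zero_add]
  have h5p : padicValRat p (2 * 2 * (p : ℚ) - -(p : ℚ)) = 1 := by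
    rw [show (2 * 2 * (p : ℚ) - -(p : ℚ)) = 5 * p by ring, padicValRat.mul h5.1 hp0, h5.2, hvp, zero_add]
  have hpos : (0 : ℚ) < p := by exact_mod_cast hp.out.pos
  rcases hmem with hm | hm
  · rcases hm with hm | ⟨-, hm⟩
    · rw [LinearEquiv.apply_symm_apply] at hm; linarith
    · rw [LinearEquiv.apply_symm_apply, h3p, hvp] at hm; norm_num at hm
  · rcases hm with hm | ⟨-, hm⟩
    · rw [LinearEquiv.apply_symm_apply] at hm; linarith
    · rw [LinearEquiv.apply_symm_apply, h5p, padicValRat.neg, hvp] at hm; norm_num at hm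

/-- **THE COSET COUNTERMODEL** (`p = 7`): typed Thm. 3.11 (i)–(iii) ∧ BridgeHyps ∧ AbsLogQPos ∧ THREE PINS, while GapA3, GapH3, the residual
`PilotKummerIndRelated` (= S), `PilotKummerCompat`, Reading R3, the licence and the Statement FAIL, `−|log(Θ)| = (5/2)·(−|log(q)|)` — in a model
where the indeterminacies MOVE the Θ-pilot region (two distinct possible images) and the holomorphic hull INFLATES every possible image strictly
(set and log-volume), over an INFINITE non-sign indeterminacy group. Interface level. [folklore] -/
theorem coset_countermodel :
    ∃ (T : ThetaIndex) (F : FullSituation T) (P : Setting F.toLatticeSituation.toSituation)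
      (ρ : (∀ v : T.V, v ∈ T.Vbad → Set (F.L.StarPacket v)) → ∀ (j : T.Label) (vQ : T.VQ), Set (F.L.Packet j vQ))
      (qK : ∀ v : T.V, v ∈ T.Vbad → Set (F.L.StarPacket v)),
      F.Statement ∧ BridgeHyps P ∧ P.AbsLogQPos ∧ PinnedRegions3 F.toLatticeSituation P ρ qK ∧
      ¬ GapA3 F.toLatticeSituation P ρ qK ∧ ¬ GapH3 F.toLatticeSituation P ρ qK ∧
      ¬ PilotKummerIndRelated F.toLatticeSituation P ρ qK ∧ ¬ PilotKummerCompat F.toLatticeSituation P qK ∧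
      (∀ (i : Fin T.lstar) (vQ : T.VQ), P.qRegion (Setting.labelSucc i) vQ ∉ P.possibleImages (Setting.labelSucc i) vQ) ∧
      ¬ Thm311ToCor312.Licence P ∧ ¬ P.Statement ∧ P.negLogTheta = (((5 : ℝ) / 2 * P.negLogQ : ℝ) : WithTop ℝ) ∧
      (∃ (j : T.Label) (vQ : T.VQ), ∃ Φ ∈ Setting.indGroup F.toSituation,
        Φ j vQ '' P.thetaRegion3 j vQ ∈ P.possibleImages j vQ ∧ Φ j vQ '' P.thetaRegion3 j vQ ≠ P.thetaRegion3 j vQ) ∧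
      (∀ (i : Fin T.lstar) (vQ : T.VQ), ∀ U ∈ P.possibleImages (Setting.labelSucc i) vQ,
        U ⊂ P.thetaHull (Setting.labelSucc i) vQ ∧
          (F.D P.n).logvol _ vQ U < (F.D P.n).logvol _ vQ (P.thetaHull (Setting.labelSucc i) vQ)) ∧
      (Setting.indGroup F.toSituation : Set F.L.PacketAut).Infinite := by
  haveI : Fact (Nat.Prime 7) := ⟨by norm_num⟩
  exact ⟨toyIndex, cFull 7, cSetting 7, cosetRegion 7, idealDatum 7, cFull_statement 7, cSetting_bridgeHyps 7, cSetting_absLogQPos 7,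
    cSetting_pinnedRegions3 7, cSetting_not_gapA3 7, (cSetting_not_gapH3 7).2, cSetting_not_pilotKummerIndRelated 7,
    cSetting_not_pilotKummerCompat 7, cSetting_qRegion_not_mem_possibleImages 7, (cSetting_not_gapH3 7).1, cSetting_not_statement 7,
    cSetting_negLogTheta_eq_mul_negLogQ 7, ⟨1, (), possibleImages_moved 7 le_rfl ()⟩, fun i vQ U hU => inflation 7 i vQ hU,
    indClosure_infinite 7⟩

/-- **The coset setting is NOT (Ind)-trivial** (`p ≥ 7`; abc-iut-w5-d068's (Ind)-triviality reading of `Cor312PinnedIndTrivial`, p429312, stated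
inline: «every indeterminacy fixes every `thetaRegion3`» FAILS here). [folklore] -/
theorem cSetting_not_indTrivial (h7 : 7 ≤ p) :
    ¬ ∀ Φ ∈ Setting.indGroup (cFull p).toSituation, ∀ (j : toyIndex.Label) (vQ : toyIndex.VQ),
        Φ j vQ '' (cSetting p).thetaRegion3 j vQ = (cSetting p).thetaRegion3 j vQ := fun hfix => by
  obtain ⟨Φ, hΦ, -, hne⟩ := possibleImages_moved p h7 ()
  exact hne (hfix Φ hΦ 1 ())

/-- … and its possible images at label `1` are NOT the singleton of the Θ-region. [folklore] -/
theorem cSetting_possibleImages_not_singleton (h7 : 7 ≤ p) (vQ : toyIndex.VQ) :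
    (cSetting p).possibleImages 1 vQ ≠ {(cSetting p).thetaRegion3 1 vQ} := fun h => by
  obtain ⟨Φ, -, hmem, hne⟩ := possibleImages_moved p h7 vQ
  rw [h, Set.mem_singleton_iff] at hmem
  exact hne hmem

/-- **INFLATION IS EXACTLY ONE VALUATION STEP, THE DEFICIT IS `j² − 1` STEPS** (the volume-form reading of the barrier, cf. abc-iut-w5-d161
2026-08-26T05:30Z OFFER / abc-iut-rp-bar BAR-S): at a label `j ∈ 𝔽_l^⋇`, every possible image `U` of the Θ-pilot object has
`μ(ⁿ˒°𝒰) = μ(U) + log p` (the indeterminacies inflate by one step, independently of `j`), while the q-pilot image has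
`μ(q-region) = μ(ⁿ˒°𝒰) + (j² − 1)·log p` (the Statement at that label would need `j² − 1` further steps). [folklore] -/
theorem inflation_exact (i : Fin toyIndex.lstar) (vQ : toyIndex.VQ) {U : Set ((unitShells p).Packet (Setting.labelSucc i) vQ)}
    (hU : U ∈ (cSetting p).possibleImages (Setting.labelSucc i) vQ) :
    (cLine p 0).logvol _ vQ ((cSetting p).thetaHull (Setting.labelSucc i) vQ) = (cLine p 0).logvol _ vQ U + Real.log p ∧
      (cLine p 0).logvol _ vQ ((cSetting p).qRegion (Setting.labelSucc i) vQ) =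
        (cLine p 0).logvol _ vQ ((cSetting p).thetaHull (Setting.labelSucc i) vQ) + ((jsq (Setting.labelSucc i) : ℝ) - 1) * Real.log p := by
  have hj := Setting.labelSucc_ne_zero i
  obtain ⟨ε, hε, rfl⟩ := possibleImages_subset p hj vQ hU
  have hc : ε * qpow p _ ≠ 0 := mul_ne_zero hε.1 (qpow_spec p (Setting.labelSucc i)).1
  have hv : padicValRat p (ε * qpow p (Setting.labelSucc i)) = jsq (Setting.labelSucc i) := by
    rw [padicValRat.mul hε.1 (qpow_spec p _).1, hε.2, zero_add, (qpow_spec p _).2]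
  rw [cSetting_thetaHull p hj, cSetting_qRegion p hj, cLine_logvol, cLine_logvol, cLine_logvol, vol'_pair p _ vQ hc, vol'_uBall,
    vol'_uBall, hv]
  constructor <;> push_cast <;> ring

end Summit.ABC.IUTFork.Cor312Vol.UnitCoset

end
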